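import Mathlib
import HarnessLib
import Summits.Ventures.LatticeQCDFlow.Scoring.SectorBottleneckFloor
import Summits.Ventures.LatticeQCDFlow.Scoring.DoeblinWindowBracket
import Summits.Ventures.LatticeQCDFlow.Scoring.FlowSamplerAutocorrelation

/-!
# The sector floor of the exact flow sampler — UNCONDITIONAL: `τ_int(1_A) ≥ (1 − π(A))/q(Aᶜ) − 1/2`
# for every topological sector `A`, with no summability or flux hypothesis left

HONEST FRAMING: exact (Metropolis-corrected) sampling algorithms for lattice gauge theory;
figures of merit are autocorrelation/cost numbers at stated couplings and volumes; no
continuum-physics claim.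

Venture `LatticeQCDFlow` (cell pub-lqcd), topic `Scoring`; FANOUT row 8 (`s0-cpn-nemc`, GEN-12).
NEW WORK of the cell, not a published result; no definition is introduced.  The bottleneck floor of
`Scoring/SectorBottleneckFloor.lean` (`a(1 − a)/Φ − 1/2 ≤ τ_int(1_A)` for reversible exact samplers;
`(1 − π(A))/q(Aᶜ) − 1/2 ≤ τ_int(1_A)` for the flow-MCMC kernel) carries two honest hypotheses —
positive exit flux and a summable autocorrelation.  A Doeblin constant BY `π` discharges both
(`Scoring/DoeblinWindowBracket.summable_acf_of_doeblin`; the flux from a sector is at least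
`ε π(A) π(Aᶜ)`), and the tree's exact flow-MCMC theorem `Exactness.flowSampler_exact_doeblin`
(row 30 / lean-2, UNCONDITIONAL via `jacobianFormula_holds`) supplies the constant `e^{−2δ}` on
`SU(n)^E`.  Printed counterparts NAMED ONLY: the conductance bound (Lawler–Sokal 1988) and the
mode-collapse barrier of flow samplers (Kanwar et al. 2020; Abbott et al. 2023, "sampling topology").

## Content

* `stayMass_le_of_doeblin` — `κ(x, ·) ≥ ε π` from every `x` gives `∫_A κ(x, A) dπ ≤
  π(A)(1 − ε(1 − π(A)))`: the exit flux of every sector is at least `ε π(A) π(Aᶜ)`;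
* **`tauInt_sector_ge_bottleneck_of_doeblin`** — `π`-reversible + Doeblin by `π` (`ε > 0`),
  `π(A) ∈ (0, 1)`: `a(1 − a)/(a − s) − 1/2 ≤ τ_int(1_A)` with NO further hypothesis (the floor and the
  Doeblin ceiling `1/ε − 1/2` of `Scoring/DoeblinAutocorrelation` then sandwich `τ_int(1_A)`);
* **`indepMH_tauInt_sector_ge_modeCollapse_of_doeblin`** — for `indepMH q w` with `w · q = π` and a
  Doeblin constant: `(1 − π(A))/q(Aᶜ) − 1/2 ≤ τ_int(1_A)` for every sector, no further hypothesis;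
* **`flowSampler_sector_floor`** — THE LATTICE, UNCONDITIONAL: under the hypotheses of
  `Scoring.flowSampler_autocorrelation` (smooth `S`, jointly smooth flow action with uniform defect
  `δ` of Lüscher's equation (4.5) on `SU(n)^E`, `𝓕` integrating `−∂S̃_t`, `q = (𝓕_1)_* D[V]`), with the
  weight `w` of `flowSampler_exact_doeblin` (`w · q = π := 𝒵⁻¹e^{−S}D[U]`, `indepMH q w` exact): for
  EVERY measurable set `A` of configurations with `0 < π(A) < 1` — a topological sector, a union of
  sectors, any event —
  `(1 − π(A))/q(Aᶜ) − 1/2 ≤ τ_int(1_A) ≤ e^{2δ} − 1/2` and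
  `π(A)(1 − π(A))/((π ⊗ K)(A × Aᶜ)) − 1/2 ≤ τ_int(1_A)`.

Reading (value-free, for the flow seat, theory-1/2, rows 11 / 30): exactness moves the flow's mode
collapse into the fitness ONE-FOR-ONE — a model that gives the complement of a sector of target mass
`π(A)` the mass `q(Aᶜ)` forces `τ_int(1_A) ≥ π(Aᶜ)/q(Aᶜ) − 1/2`, at every volume, whatever the mean
acceptance; the under-coverage ratio `π(Aᶜ)/q(Aᶜ)` IS a certified lower bound on the sector
autocorrelation time.  NOT CLAIMED: any value of `q(Aᶜ)`, `π(A)` or `δ` for a concrete flow (measured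
/ theory-1's `TrivializingMaps/*`); anything for non-reversible samplers.
-/

noncomputable section

namespace Summit.Ventures.LatticeQCDFlow.Scoring

open MeasureTheory ProbabilityTheory Filter Set Summit.Ventures.LatticeQCDFlow.Exactness
open scoped ENNReal Topology

variable {Ω : Type*} [MeasurableSpace Ω]

/-! ### §1 Reversible Doeblin kernels: the floor with no extra hypothesis -/

section Doeblin

variable {κ : Kernel Ω Ω} [IsMarkovKernel κ] {π : Measure Ω} [IsProbabilityMeasure π] {ε : ℝ≥0∞}
  {A : Set Ω}

/-- Under `κ(x, ·) ≥ ε π` the stay mass of a sector is at most `π(A)(1 − ε(1 − π(A)))`: the exit flux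
is at least `ε π(A) π(Aᶜ)`. -/
theorem stayMass_le_of_doeblin (hmin : ∀ x {B : Set Ω}, MeasurableSet B → ε * π B ≤ κ x B)
    (hA : MeasurableSet A) :
    ∫ x in A, (κ x).real A ∂π ≤ π.real A * (1 - ε.toReal * (1 - π.real A)) := by
  have hε1 : ε ≤ 1 := eps_le_one_of_doeblin hmin
  have hεtop : ε ≠ ⊤ := ne_top_of_le_ne_top ENNReal.one_ne_top hε1
  have hcA : π.real Aᶜ = 1 - π.real A := by
    rw [measureReal_compl hA, probReal_univ]
  have hpt : ∀ x, (κ x).real A ≤ 1 - ε.toReal * (1 - π.real A) := fun x => by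
    have hc : ε.toReal * π.real Aᶜ ≤ (κ x).real Aᶜ := by
      have h := hmin x hA.compl
      have h' := ENNReal.toReal_mono (measure_ne_top _ _) h
      rwa [ENNReal.toReal_mul, ← measureReal_def, ← measureReal_def] at h'
    have hsplit : (κ x).real A + (κ x).real Aᶜ = 1 := by
      rw [← measureReal_union disjoint_compl_right hA.compl, Set.union_compl_self, probReal_univ]
    rw [hcA] at hc
    linarith
  calc ∫ x in A, (κ x).real A ∂π ≤ ∫ _ in A, (1 - ε.toReal * (1 - π.real A)) ∂π := by
        refine integral_mono_of_nonneg (ae_of_all _ fun x => measureReal_nonneg)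
          (integrable_const _) (ae_of_all _ hpt)
    _ = π.real A * (1 - ε.toReal * (1 - π.real A)) := by
        rw [integral_const, smul_eq_mul]
        simp only [measureReal_def, Measure.restrict_apply_univ]

/-- **The bottleneck floor with no extra hypothesis**: `κ` Markov, `π`-reversible, minorised by `π`
itself (`ε > 0`); then every sector with `π(A) ∈ (0, 1)` has
`a(1 − a)/(a − s) − 1/2 ≤ τ_int(1_A)` (`a = π(A)`, `s = ∫_A κ(x, A) dπ`). -/
theorem tauInt_sector_ge_bottleneck_of_doeblin (hrev : Kernel.IsReversible κ π)
    (hmin : ∀ x {B : Set Ω}, MeasurableSet B → ε * π B ≤ κ x B) (hε0 : 0 < ε)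
    (hA : MeasurableSet A) (ha0 : 0 < π.real A) (ha1 : π.real A < 1) :
    π.real A * (1 - π.real A) / (π.real A - ∫ x in A, (κ x).real A ∂π) - 1 / 2
      ≤ tauInt (fun t => autocov κ π (fun x => A.indicator (1 : Ω → ℝ) x - π.real A) t
          / autocov κ π (fun x => A.indicator (1 : Ω → ℝ) x - π.real A) 0) := by
  have hε1 : ε ≤ 1 := eps_le_one_of_doeblin hmin
  have hεr0 : 0 < ε.toReal :=
    ENNReal.toReal_pos hε0.ne' (ne_top_of_le_ne_top ENNReal.one_ne_top hε1)
  have hstay := stayMass_le_of_doeblin hmin hA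
  have hflux : ∫ x in A, (κ x).real A ∂π < π.real A := by
    have : 0 < π.real A * (ε.toReal * (1 - π.real A)) := mul_pos ha0 (mul_pos hεr0 (by linarith))
    nlinarith
  have hs := summable_acf_of_doeblin hrev.invariant hmin hε0 (measurable_centredIndicator hA _)
    (abs_centredIndicator_le (π := π) A) (integral_centredIndicator hA)
  exact tauInt_sector_ge_bottleneck hrev hA ha0 ha1 hflux hs

end Doeblin

/-! ### §2 The flow-MCMC kernel with a Doeblin constant -/

section IMH

variable {q : Measure Ω} [IsProbabilityMeasure q] {w : Ω → ℝ} {π : Measure Ω}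
  [IsProbabilityMeasure π] {ε : ℝ≥0∞} {A : Set Ω}

/-- **Mode collapse prices itself, no extra hypothesis**: for `indepMH q w` with `w · q = π` and a
Doeblin constant `ε > 0`, every sector with `π(A) ∈ (0, 1)` has
`(1 − π(A))/q(Aᶜ) − 1/2 ≤ τ_int(1_A)`. -/
theorem indepMH_tauInt_sector_ge_modeCollapse_of_doeblin (hw : Measurable w) (hw0 : ∀ x, 0 < w x)
    (hπ : (q.withDensity fun x => ENNReal.ofReal (w x)) = π)
    (hmin : ∀ x {B : Set Ω}, MeasurableSet B → ε * π B ≤ indepMH q w x B) (hε0 : 0 < ε)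
    (hA : MeasurableSet A) (ha0 : 0 < π.real A) (ha1 : π.real A < 1) :
    (1 - π.real A) / q.real Aᶜ - 1 / 2
      ≤ tauInt (fun t => autocov (indepMH q w) π (fun x => A.indicator (1 : Ω → ℝ) x - π.real A) t
          / autocov (indepMH q w) π (fun x => A.indicator (1 : Ω → ℝ) x - π.real A) 0) := by
  haveI : Fact (Measurable w) := ⟨hw⟩
  have hrev : Kernel.IsReversible (indepMH q w) π := by
    rw [← hπ]; exact indepMH_isReversible hw hw0
  have hε1 : ε ≤ 1 := eps_le_one_of_doeblin hmin
  have hεr0 : 0 < ε.toReal :=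
    ENNReal.toReal_pos hε0.ne' (ne_top_of_le_ne_top ENNReal.one_ne_top hε1)
  have hstay := stayMass_le_of_doeblin hmin hA
  have hflux : ∫ x in A, (indepMH q w x).real A ∂π < π.real A := by
    have : 0 < π.real A * (ε.toReal * (1 - π.real A)) := mul_pos ha0 (mul_pos hεr0 (by linarith))
    nlinarith
  have hs := summable_acf_of_doeblin hrev.invariant hmin hε0 (measurable_centredIndicator hA _)
    (abs_centredIndicator_le (π := π) A) (integral_centredIndicator hA)
  exact indepMH_tauInt_sector_ge_modeCollapse hw hw0 hπ hA ha0 ha1 hflux hs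

end IMH

/-! ### §3 The lattice: the exact flow sampler on `SU(n)^E` — UNCONDITIONAL -/

section Lattice

open Literature.MathematicalPhysics.QuantumFieldTheory
open Literature.MathematicalPhysics.QuantumFieldTheory.Luscher2010
open Summit.Ventures.LatticeQCDFlow.TrivializingMaps
open scoped Matrix Matrix.Norms.Frobenius ContDiff

variable {d L n : ℕ} [NeZero L]

/-- **THE SECTOR FLOOR OF THE EXACT FLOW SAMPLER — UNCONDITIONAL.**  Under the hypotheses of
`Scoring.flowSampler_autocorrelation`: with the weight `w` of `flowSampler_exact_doeblin`
(`w · q = π := 𝒵⁻¹e^{−S}D[U]`, `indepMH q w` EXACT), for every measurable set `A` of configurations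
with `0 < π(A) < 1` the centred indicator `1_A − π(A)` has
`(1 − π(A))/q(Aᶜ) − 1/2 ≤ τ_int(1_A)`, `π(A)(1 − π(A))/(π(A) − ∫_A K(U, A) dπ) − 1/2 ≤ τ_int(1_A)`
and `τ_int(1_A) ≤ e^{2δ} − 1/2`. -/
theorem flowSampler_sector_floor (B : SuBasis n)
    {S : AmbConfig d L n → ℝ} (hS : ContDiff ℝ ∞ S) {F : ℝ → AmbConfig d L n → ℝ}
    (hF : ContDiff ℝ ∞ fun p : ℝ × AmbConfig d L n => F p.1 p.2)
    {Φ : ℝ → GaugeConfig d L (Matrix.specialUnitaryGroup (Fin n) ℂ) →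
      GaugeConfig d L (Matrix.specialUnitaryGroup (Fin n) ℂ)}
    (hΦ : IsFlowMap (fun t W => -linkGrad B (F t) W) Φ) {c : ℝ → ℝ} {δ : ℝ}
    (hδ : ∀ t ∈ Set.Icc (0 : ℝ) 1, ∀ U : GaugeConfig d L (Matrix.specialUnitaryGroup (Fin n) ℂ),
      |luscherL B S t (F t) (WilsonFlow.coeConfig U) - S (WilsonFlow.coeConfig U) - c t| ≤ δ)
    (q : Measure (GaugeConfig d L (Matrix.specialUnitaryGroup (Fin n) ℂ))) [IsProbabilityMeasure q]
    (hq : q = Measure.map (Φ 1) (trivialMeasure (Matrix.specialUnitaryGroup (Fin n) ℂ) d L)) :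
    ∃ w : GaugeConfig d L (Matrix.specialUnitaryGroup (Fin n) ℂ) → ℝ, Measurable w ∧
      (q.withDensity fun U => ENNReal.ofReal (w U)) =
        boltzmannMeasure (fun U : GaugeConfig d L (Matrix.specialUnitaryGroup (Fin n) ℂ) =>
          S (WilsonFlow.coeConfig U)) ∧
      Kernel.Invariant (indepMH q w)
        (boltzmannMeasure fun U : GaugeConfig d L (Matrix.specialUnitaryGroup (Fin n) ℂ) =>
          S (WilsonFlow.coeConfig U)) ∧
      ∀ (A : Set (GaugeConfig d L (Matrix.specialUnitaryGroup (Fin n) ℂ))), MeasurableSet A →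
        0 < (boltzmannMeasure fun U : GaugeConfig d L (Matrix.specialUnitaryGroup (Fin n) ℂ) =>
          S (WilsonFlow.coeConfig U)).real A →
        (boltzmannMeasure fun U : GaugeConfig d L (Matrix.specialUnitaryGroup (Fin n) ℂ) =>
          S (WilsonFlow.coeConfig U)).real A < 1 →
        let π := boltzmannMeasure fun U : GaugeConfig d L (Matrix.specialUnitaryGroup (Fin n) ℂ) =>
          S (WilsonFlow.coeConfig U)
        let ρ : ℕ → ℝ := fun t =>
          autocov (indepMH q w) π (fun U => A.indicator 1 U - π.real A) t
            / autocov (indepMH q w) π (fun U => A.indicator 1 U - π.real A) 0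
        (1 - π.real A) / q.real Aᶜ - 1 / 2 ≤ tauInt ρ ∧
        π.real A * (1 - π.real A) / (π.real A - ∫ U in A, (indepMH q w U).real A ∂π) - 1 / 2
          ≤ tauInt ρ ∧
        tauInt ρ ≤ Real.exp (2 * δ) - 1 / 2 := by
  obtain ⟨w, hw, hwlo, -, hπ, hinv, -, hdoeb⟩ := flowSampler_exact_doeblin B hS hF hΦ hδ q hq
  haveI : Fact (Measurable w) := ⟨hw⟩
  have hS'c : Continuous fun U : GaugeConfig d L (Matrix.specialUnitaryGroup (Fin n) ℂ) =>
      S (WilsonFlow.coeConfig U) := hS.continuous.comp WilsonFlow.continuous_coeConfig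
  haveI := isProbabilityMeasure_boltzmannMeasure (d := d) (L := L) hS'c
  have hw0 : ∀ U, 0 < w U := fun U => (Real.exp_pos _).trans_le (hwlo U)
  have hε0 : 0 < ENNReal.ofReal (Real.exp (-(2 * δ))) := ENNReal.ofReal_pos.2 (Real.exp_pos _)
  have hrev : Kernel.IsReversible (indepMH q w)
      (boltzmannMeasure fun U : GaugeConfig d L (Matrix.specialUnitaryGroup (Fin n) ℂ) =>
        S (WilsonFlow.coeConfig U)) := by
    rw [← hπ]; exact indepMH_isReversible hw hw0
  refine ⟨w, hw, hπ, hinv, fun A hA ha0 ha1 => ⟨?_, ?_, ?_⟩⟩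
  · exact indepMH_tauInt_sector_ge_modeCollapse_of_doeblin hw hw0 hπ (fun x B hB => hdoeb x hB)
      hε0 hA ha0 ha1
  · exact tauInt_sector_ge_bottleneck_of_doeblin hrev (fun x B hB => hdoeb x hB) hε0 hA ha0 ha1
  · exact tauInt_le_exp_of_doeblin (M := 2 * δ) hinv (fun x B hB => hdoeb x hB)
      (measurable_centredIndicator hA _) (abs_centredIndicator_le A) (integral_centredIndicator hA)

end Lattice

end Summit.Ventures.LatticeQCDFlow.Scoring

end
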